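import Mathlib
import HarnessLib.Audit
import Summits.PneNP.PneNP.Theorems.PstarRankRigidityFour
import Summits.PneNP.PneNP.Theorems.PstarEdgeRankTwo

/-!
# The forcing dichotomy for a chord of rank four (ROUND-24, memo `CORE-BOUND-NOTES.md` §10 (★★) / §13 R5–R7)

FRONTIER range-avoidance ladder, rung F-N3, ROUND 24 (cell `pnp-ideate`, planner memo `r24/CORE-BOUND-NOTES.md` §10 R7 case table and §13
"R5–R7 classification of `q = w₂|V₀` forcing"; restricted-model proof complexity — nothing here bears on `P` versus `NP`).

In the single-read regime of the memo a forced chord `e` contributes a quadratic `Q = Q_{P_e}` of RANK AT LEAST FOUR (R3) with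
`Q ≡ γ_e + 1` on `Z = {q = 0}` (`q := w₂|V₀ + t₂`; memo (★★)).  Feeding the hypothesis "rank `Q ≥ 4`" into the umbrella
`PstarRankRigidityFour.classification` kills the small cases, leaving the **forcing dichotomy** (`forcing_cases`): one of

* (Z∅)  `q ≡ 1` — `Z` is empty, the constraint `w₂` is violated identically on `V₀` (memo R6/R7(iv): an `h = 1` configuration, no core);
* (EQ)  `Q = q + κ` — the chord's path form IS the constraint (memo R7(i): all forced chords have the same path form);
* (EXC) `Q = q + ν₁ν₂ + κ` with `ν₁, ν₂` affine — the elliptic rank-four bundle exception (memo R7(i′));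
* (NOR) `q = λ₁λ₂ + 1` is the indicator complement of a codimension-two flat `{λ₁ = λ₂ = 1}` (`B a b = 1`) and
        `Q + c = (λ₁+1) m₁ + (λ₂+1) m₂` with `m₁, m₂` affine — the NOR structure (memo R7(iii)).

In particular an AFFINE non-constant `q` (a pin or a linear read, memo R7(iv)) and a rank-two `q` of OR type (R7(ii)) force nothing of rank four
(`not_forced_of_affine`).  Supporting lemmas: `exists_ne_of_rank_four` (rank `≥ 4` ⇒ non-constant), `not_rank_four_of_mul` (a product of two
affine functions plus a constant has rank `≤ 2`), and — for the combinatorial reading of (EQ) — `edges_eq_of_qform_eq`: two simple graphs whose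
edge sums differ by a constant are EQUAL (so (EQ) for two chords means equal fundamental paths, memo R7(i) "same path ⟹ `#N ≤ 1`").
-/

set_option linter.dupNamespace false -- `Summit.PneNP.PneNP.…`: summit = sub-problem name (D-0017 single-conjunct layout)

open Finset Module
open Summit.PneNP.PneNP.Theorems.PstarCubeIdeals (IsAffineFn IsQuadFn isAffineFn_const)
open Summit.PneNP.PneNP.Theorems.PstarQuadRank (rad mem_rad polar_eq_zero_of_const)
open Summit.PneNP.PneNP.Theorems.PstarRankRigidityTwo (linPart symForm symForm_apply linPart_apply affine_mul_polar finrank_le_rad_symForm)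
open Summit.PneNP.PneNP.Theorems.PstarRankRigidityFour (classification)
open Summit.PneNP.PneNP.Theorems.PstarProductRank (qform polar qform_add)
open Summit.PneNP.PneNP.Theorems.PstarGraphQuadGap (Edge Simple)
open Summit.PneNP.PneNP.Theorems.PstarEdgeRankTwo (polar_single_single)

namespace Summit.PneNP.PneNP.Theorems.PstarForcing

/-- Every element of `𝔽₂` is `0` or `1`. -/
private theorem zmod2_cases (t : ZMod 2) : t = 0 ∨ t = 1 := by
  revert t; decide

/-- In `𝔽₂`, `x + x = 0`. -/
private theorem zmod2_add_self (x : ZMod 2) : x + x = 0 := by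
  revert x; decide

variable {M : Type*} [AddCommGroup M] [Module (ZMod 2) M] [Fintype M] [DecidableEq M]

omit [DecidableEq M] in
/-- **Rank at least four is non-constant** (indeed rank `≥ 1` suffices): a constant function has polar form `0` and radical everything. -/
theorem exists_ne_of_rank_four {Q : M → ZMod 2} {B : LinearMap.BilinForm (ZMod 2) M} (hB : ∀ x w, Q (x + w) = Q x + Q w + Q 0 + B x w)
    (hrank : finrank (ZMod 2) (rad B) + 4 ≤ finrank (ZMod 2) M) : ∃ v, Q v ≠ Q 0 := by
  by_contra hno
  push Not at hno
  have h0 : ∀ x w, B x w = 0 := polar_eq_zero_of_const hB hno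
  have htop : rad B = ⊤ := by
    rw [eq_top_iff]
    intro x _
    exact mem_rad.2 (h0 x)
  rw [htop, finrank_top] at hrank
  omega

omit [Fintype M] [DecidableEq M] in
/-- The polar form is determined by the function. -/
theorem polar_unique {Q : M → ZMod 2} {B B' : LinearMap.BilinForm (ZMod 2) M} (hB : ∀ x w, Q (x + w) = Q x + Q w + Q 0 + B x w)
    (hB' : ∀ x w, Q (x + w) = Q x + Q w + Q 0 + B' x w) : B = B' := by
  refine LinearMap.ext₂ fun x w => ?_
  have h := (hB x w).symm.trans (hB' x w)
  have e : ∀ s t u : ZMod 2, s + t = s + u → t = u := fun s t u h => by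
    have := congrArg (fun z => s + z) h; simpa [← add_assoc, zmod2_add_self] using this
  exact e _ _ _ h

omit [DecidableEq M] in
/-- **A product of two affine functions plus a constant has rank at most two**: it is not of rank four. -/
theorem not_rank_four_of_mul {Q : M → ZMod 2} {B : LinearMap.BilinForm (ZMod 2) M} (hB : ∀ x w, Q (x + w) = Q x + Q w + Q 0 + B x w)
    {μ₁ μ₂ : M → ZMod 2} (h₁ : IsAffineFn μ₁) (h₂ : IsAffineFn μ₂) {κ : ZMod 2} (hQ : ∀ x, Q x = μ₁ x * μ₂ x + κ) :
    ¬ finrank (ZMod 2) (rad B) + 4 ≤ finrank (ZMod 2) M := by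
  have hB' : ∀ x w, Q (x + w) = Q x + Q w + Q 0 + symForm (linPart h₁) (linPart h₂) x w := by
    intro x w
    rw [hQ, hQ, hQ, hQ 0, affine_mul_polar h₁ h₂]
    generalize μ₁ x * μ₂ x = s; generalize μ₁ w * μ₂ w = s'; generalize μ₁ 0 * μ₂ 0 = s₀
    generalize symForm (linPart h₁) (linPart h₂) x w = t
    generalize κ = k
    revert s s' s₀ t k; decide
  rw [polar_unique hB hB']
  have h := finrank_le_rad_symForm (M := M) (linPart h₁) (linPart h₂)
  omega

omit [DecidableEq M] in
/-- **The forcing dichotomy (memo (★★) through the R7 table).**  `q` quadratic with polar form `B`, `Q` quadratic of rank `≥ 4` with polar form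
`B'`, and `Q ≡ c` on `Z(q)`.  Then: `q ≡ 1` (empty `Z`), or `Q = q + κ`, or `Q = q + ν₁ν₂ + κ` (`ν₁, ν₂` affine), or `Z(q)` is the
codimension-two NOR flat and `Q + c` lies in its ideal in the explicit form `(λ₁+1)m₁ + (λ₂+1)m₂`. -/
theorem forcing_cases {q Q : M → ZMod 2} {B B' : LinearMap.BilinForm (ZMod 2) M}
    (hB : ∀ x w, q (x + w) = q x + q w + q 0 + B x w) (hB' : ∀ x w, Q (x + w) = Q x + Q w + Q 0 + B' x w)
    (hrank : finrank (ZMod 2) (rad B') + 4 ≤ finrank (ZMod 2) M) {c : ZMod 2} (hZ : ∀ x, q x = 0 → Q x = c) :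
    (∀ x, q x = 1) ∨
    (∃ κ : ZMod 2, ∀ x, Q x = q x + κ) ∨
    (∃ ν₁ ν₂ : M → ZMod 2, IsAffineFn ν₁ ∧ IsAffineFn ν₂ ∧ ∃ κ : ZMod 2, ∀ x, Q x = q x + ν₁ x * ν₂ x + κ) ∨
    (∃ a b : M, B a b = 1 ∧ (∀ x, q x = (B x b + (q b + q 0)) * (B x a + (q a + q 0)) + 1) ∧
      ∃ m₁ m₂ : M → ZMod 2, IsAffineFn m₁ ∧ IsAffineFn m₂ ∧
        ∀ x, Q x + c = (B x b + (q b + q 0) + 1) * m₁ x + (B x a + (q a + q 0) + 1) * m₂ x) := by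
  classical
  have hQnc := exists_ne_of_rank_four hB' hrank
  -- the shifted function `g := Q + c` vanishes on `Z(q)` and is quadratic
  have hg : IsQuadFn (fun x => Q x + c) := by
    refine ⟨B', fun x w => ?_⟩
    show Q (x + w) + c = Q x + c + (Q w + c) + (Q 0 + c) + B' x w
    rw [hB']
    generalize Q x = s; generalize Q w = s'; generalize Q 0 = s₀; generalize B' x w = t
    generalize c = k
    revert s s' s₀ t k; decide
  have hZ' : ∀ x, q x = 0 → Q x + c = 0 := fun x hx => by rw [hZ x hx, zmod2_add_self]
  have eadd : ∀ s t u : ZMod 2, s + t = u → s = u + t := by decide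
  by_cases hq : ∃ v, q v ≠ q 0
  · rcases classification hB hq hg hZ' with (h | h) | ⟨μ₁, μ₂, hμ₁, hμ₂, h | h⟩ | ⟨a, b, hab, hqf, m₁, m₂, hm₁, hm₂, h⟩
    · -- `Q + c ≡ 0`: `Q` constant, contradicting rank four
      exfalso
      obtain ⟨v, hv⟩ := hQnc
      exact hv (by rw [eadd _ _ _ (h v), eadd _ _ _ (h 0)])
    · exact Or.inr (Or.inl ⟨c, fun x => eadd _ _ _ (h x)⟩)
    · -- `Q + c = μ₁ μ₂`: rank at most two, contradiction
      exact absurd hrank (not_rank_four_of_mul hB' hμ₁ hμ₂ (κ := c) fun x => eadd _ _ _ (h x))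
    · refine Or.inr (Or.inr (Or.inl ⟨μ₁, μ₂, hμ₁, hμ₂, c, fun x => ?_⟩))
      have hx := h x
      revert hx
      generalize Q x = s; generalize q x = t; generalize μ₁ x * μ₂ x = u
      generalize c = k
      revert s t u k; decide
    · exact Or.inr (Or.inr (Or.inr ⟨a, b, hab, hqf, m₁, m₂, hm₁, hm₂, h⟩))
  · -- `q` constant: `Z(q)` is everything (then `Q` is constant — impossible) or empty
    push Not at hq
    rcases zmod2_cases (q 0) with h0 | h1
    · exfalso
      obtain ⟨v, hv⟩ := hQnc
      exact hv (by rw [hZ v (by rw [hq v, h0]), hZ 0 h0])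
    · exact Or.inl fun x => by rw [hq x, h1]

omit [DecidableEq M] in
/-- **Affine constraints force no rank-four chord** (memo R7(iv): pins and linear reads): if `q` is affine and some `Q` of rank `≥ 4` is constant
on `Z(q)`, then `Z(q) = ∅`. -/
theorem not_forced_of_affine {q Q : M → ZMod 2} (hq : IsAffineFn q) {B' : LinearMap.BilinForm (ZMod 2) M}
    (hB' : ∀ x w, Q (x + w) = Q x + Q w + Q 0 + B' x w) (hrank : finrank (ZMod 2) (rad B') + 4 ≤ finrank (ZMod 2) M) {c : ZMod 2}
    (hZ : ∀ x, q x = 0 → Q x = c) : ∀ x, q x = 1 := by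
  classical
  have hB : ∀ x w, q (x + w) = q x + q w + q 0 + (0 : LinearMap.BilinForm (ZMod 2) M) x w := fun x w => by
    rw [hq x w, LinearMap.zero_apply, LinearMap.zero_apply, add_zero]
  rcases forcing_cases hB hB' hrank hZ with h | ⟨κ, h⟩ | ⟨ν₁, ν₂, hν₁, hν₂, κ, h⟩ | ⟨a, b, hab, -⟩
  · exact h
  · -- `Q = q + κ` is affine: rank `0`
    exfalso
    refine not_rank_four_of_mul hB' hq (isAffineFn_const (M := M) 1) (κ := κ) (fun x => ?_) hrank
    rw [h x, mul_one]
  · -- `Q = q + ν₁ν₂ + κ`: polar form `symForm`, rank `≤ 2`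
    exfalso
    have hB'' : ∀ x w, Q (x + w) = Q x + Q w + Q 0 + symForm (linPart hν₁) (linPart hν₂) x w := by
      intro x w
      rw [h, h, h, h 0, hq x w, affine_mul_polar hν₁ hν₂]
      generalize q x = s; generalize q w = s'; generalize q 0 = s₀
      generalize ν₁ x * ν₂ x = u; generalize ν₁ w * ν₂ w = u'; generalize ν₁ 0 * ν₂ 0 = u₀
      generalize symForm (linPart hν₁) (linPart hν₂) x w = t
      generalize κ = k
      revert s s' s₀ u u' u₀ t k; decide
    rw [polar_unique hB' hB''] at hrank
    have h2 := finrank_le_rad_symForm (M := M) (linPart hν₁) (linPart hν₂)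
    omega
  · exact absurd hab (by rw [LinearMap.zero_apply, LinearMap.zero_apply]; exact zero_ne_one)

/-! ## Reading (EQ) combinatorially: the edge sum determines the graph -/

/-- **Two simple graphs whose edge sums differ by a constant are equal** (compare polar forms on basis vectors,
`PstarEdgeRankTwo.polar_single_single`). -/
theorem edges_eq_of_qform_eq {V : ℕ} {T T' : Finset (Edge V)} (hS : Simple T) (hS' : Simple T') {κ : ZMod 2}
    (h : ∀ a : Fin V → ZMod 2, qform T Prod.fst Prod.snd a = qform T' Prod.fst Prod.snd a + κ) : T = T' := by
  classical
  -- the constant is `0` (evaluate at `a = 0`)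
  have hκ : κ = 0 := by
    have h0 := h 0
    simp only [qform, Pi.zero_apply, mul_zero, sum_const_zero, zero_add] at h0
    exact h0.symm
  subst hκ
  -- polar forms agree
  have hpol : ∀ v w : Fin V → ZMod 2, polar T Prod.fst Prod.snd v w = polar T' Prod.fst Prod.snd v w := by
    intro v w
    have h1 := qform_add T Prod.fst Prod.snd v w
    have h2 := qform_add T' Prod.fst Prod.snd v w
    rw [h (v + w), h v, h w, h2] at h1
    generalize qform T' Prod.fst Prod.snd v = s at h1; generalize qform T' Prod.fst Prod.snd w = s' at h1
    generalize polar T Prod.fst Prod.snd v w = t at h1; generalize polar T' Prod.fst Prod.snd v w = t' at h1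
    revert s s' t t' h1; decide
  -- hence adjacency agrees
  have hadj : ∀ p q : Fin V, ((p, q) ∈ T ∨ (q, p) ∈ T) ↔ ((p, q) ∈ T' ∨ (q, p) ∈ T') := by
    intro p q
    have e := hpol (Pi.single p 1) (Pi.single q 1)
    rw [polar_single_single hS, polar_single_single hS'] at e
    by_cases h1 : ((p, q) ∈ T ∨ (q, p) ∈ T) <;> by_cases h2 : ((p, q) ∈ T' ∨ (q, p) ∈ T') <;>
      simp only [h1, h2, if_true, if_false] at e ⊢
    · exact absurd e one_ne_zero
    · exact absurd e zero_ne_one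
  -- and the edge sets (increasing pairs) agree
  ext ⟨p, q⟩
  constructor
  · intro hpq
    rcases (hadj p q).1 (Or.inl hpq) with h' | h'
    · exact h'
    · exact absurd (lt_trans (hS _ hpq) (hS' _ h')) (lt_irrefl _)
  · intro hpq
    rcases (hadj p q).2 (Or.inl hpq) with h' | h'
    · exact h'
    · exact absurd (lt_trans (hS' _ hpq) (hS _ h')) (lt_irrefl _)

/-! ## Sharp cases: translation, positive bias, rank six force (EQ) only -/

omit [DecidableEq M] in
/-- From `g := Q + c ∈ {0, q}` and rank `Q ≥ 4` to (EQ): `Q = q + κ`. -/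
theorem eq_of_zero_or_eq {q Q : M → ZMod 2} {B' : LinearMap.BilinForm (ZMod 2) M}
    (hB' : ∀ x w, Q (x + w) = Q x + Q w + Q 0 + B' x w) (hrank : finrank (ZMod 2) (rad B') + 4 ≤ finrank (ZMod 2) M) {c : ZMod 2}
    (h : (∀ x, Q x + c = 0) ∨ (∀ x, Q x + c = q x)) : ∃ κ : ZMod 2, ∀ x, Q x = q x + κ := by
  have eadd : ∀ s t u : ZMod 2, s + t = u → s = u + t := by decide
  rcases h with h | h
  · exfalso
    obtain ⟨v, hv⟩ := exists_ne_of_rank_four hB' hrank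
    exact hv (by rw [eadd _ _ _ (h v), eadd _ _ _ (h 0)])
  · exact ⟨c, fun x => eadd _ _ _ (h x)⟩

omit [Fintype M] [DecidableEq M] in
/-- The shifted chord form `Q + c` is quadratic and vanishes on `Z(q)`. -/
theorem shift_quad {q Q : M → ZMod 2} {B' : LinearMap.BilinForm (ZMod 2) M} (hB' : ∀ x w, Q (x + w) = Q x + Q w + Q 0 + B' x w)
    {c : ZMod 2} (hZ : ∀ x, q x = 0 → Q x = c) : IsQuadFn (fun x => Q x + c) ∧ ∀ x, q x = 0 → Q x + c = 0 := by
  refine ⟨⟨B', fun x w => ?_⟩, fun x hx => by rw [hZ x hx, zmod2_add_self]⟩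
  show Q (x + w) + c = Q x + c + (Q w + c) + (Q 0 + c) + B' x w
  rw [hB']
  generalize Q x = s; generalize Q w = s'; generalize Q 0 = s₀; generalize B' x w = t
  generalize c = k
  revert s s' s₀ t k; decide

omit [DecidableEq M] in
/-- **A translation direction of `q` forces (EQ).**  If `q (x + r) = q x + 1` for all `x` (e.g. a variable read linearly and nowhere else), then a
rank-`≥ 4` form `Q` constant on `Z(q)` is `q + κ` — no exception, no NOR case (`PstarRankRigidityTwo.eq_zero_or_eq_or_mul_of_translation`). -/
theorem forcing_of_translation {q Q : M → ZMod 2} {B B' : LinearMap.BilinForm (ZMod 2) M}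
    (hB : ∀ x w, q (x + w) = q x + q w + q 0 + B x w) {r : M} (hr : ∀ x, q (x + r) = q x + 1)
    (hB' : ∀ x w, Q (x + w) = Q x + Q w + Q 0 + B' x w) (hrank : finrank (ZMod 2) (rad B') + 4 ≤ finrank (ZMod 2) M) {c : ZMod 2}
    (hZ : ∀ x, q x = 0 → Q x = c) : ∃ κ : ZMod 2, ∀ x, Q x = q x + κ := by
  obtain ⟨hg, hZ'⟩ := shift_quad hB' hZ
  rcases PstarRankRigidityTwo.eq_zero_or_eq_or_mul_of_translation hB hr hg hZ' with h | h | ⟨α, β, hα, hβ, h⟩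
  · exact eq_of_zero_or_eq hB' hrank (Or.inl h)
  · exact eq_of_zero_or_eq hB' hrank (Or.inr h)
  · have eadd : ∀ s t u : ZMod 2, s + t = u → s = u + t := by decide
    exact absurd hrank (not_rank_four_of_mul hB' hα hβ (κ := c) fun x => eadd _ _ _ (h x))

omit [DecidableEq M] in
/-- **Positive bias of `q` forces (EQ)** (`PstarRankRigidity.eq_zero_or_eq_of_bias_pos`; e.g. `q` a sum of AND-disjoint monomials). -/
theorem forcing_of_bias_pos {q Q : M → ZMod 2} {B B' : LinearMap.BilinForm (ZMod 2) M}
    (hB : ∀ x w, q (x + w) = q x + q w + q 0 + B x w) {a b : M} (hab : B a b ≠ 0) (hpos : 0 < PstarQuadRank.bias q)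
    (hB' : ∀ x w, Q (x + w) = Q x + Q w + Q 0 + B' x w) (hrank : finrank (ZMod 2) (rad B') + 4 ≤ finrank (ZMod 2) M) {c : ZMod 2}
    (hZ : ∀ x, q x = 0 → Q x = c) : ∃ κ : ZMod 2, ∀ x, Q x = q x + κ := by
  classical
  obtain ⟨hg, hZ'⟩ := shift_quad hB' hZ
  exact eq_of_zero_or_eq hB' hrank (PstarRankRigidity.eq_zero_or_eq_of_bias_pos hB hab hpos hg hZ')

omit [DecidableEq M] in
/-- **Rank six of `q` forces (EQ)** (`PstarRankRigidity.eq_zero_or_eq_of_rank_six`). -/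
theorem forcing_of_rank_six {q Q : M → ZMod 2} {B B' : LinearMap.BilinForm (ZMod 2) M}
    (hB : ∀ x w, q (x + w) = q x + q w + q 0 + B x w) (hrank6 : finrank (ZMod 2) (rad B) + 6 ≤ finrank (ZMod 2) M)
    (hB' : ∀ x w, Q (x + w) = Q x + Q w + Q 0 + B' x w) (hrank : finrank (ZMod 2) (rad B') + 4 ≤ finrank (ZMod 2) M) {c : ZMod 2}
    (hZ : ∀ x, q x = 0 → Q x = c) : ∃ κ : ZMod 2, ∀ x, Q x = q x + κ := by
  classical
  obtain ⟨hg, hZ'⟩ := shift_quad hB' hZ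
  exact eq_of_zero_or_eq hB' hrank (PstarRankRigidity.eq_zero_or_eq_of_rank_six hB hrank6 hg hZ')

end Summit.PneNP.PneNP.Theorems.PstarForcing
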